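/-
Copyright (c) 2026 the pub-hodgecm-mathlib formalisation cell (harness21).  Prover seat hodgecm-mathlib-B-p04 (g61), req618 STAGE 1a «FOUR-FRAME» squad (director s1808;
LEAD directive v1.1 d3f1616d0136e728 D7 «B-p04 — dictionary support»): the EIGENFRAME of the four-frame literal `z·Γ_b` — the regularity∕ellipticity input of every
row Prop of the road ((D-G) census dictionary, (D-CΔ), (D-H)), over the ★ notions module `UnitaryThreeFourFrameDefs` (p854559).  2026-09-03.
-/
import Literature.NumberTheory.Automorphic.UnitaryThreeFourFrameDefectModuleShape     -- ★ p854564 (B-p08): `frameProj_mulVec`; brings ★ p854563 P-1…P-4 and ★ #0a `frameProj`, `frameElt`, `IsFourFrameFamily`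
import Mathlib.LinearAlgebra.Matrix.Charpoly.Basic
import HarnessLib

/-!
# The eigenframe of the four-frame literal: `(z·Γ_b)·Q_b = Q_b·diag(zα, zβ, z)` with `Q_b` = the frame matrix, invertible; the characteristic polynomial is
# `(X − zα)(X − zβ)(X − z)`, separable for a regular datum (Rogawski 1990 §3.6, §4.9; Jacobowitz 1962 §4)

Topic `NumberTheory/Automorphic`; namespace `Literature.NumberTheory.Automorphic.UnitaryThreeFourFrame`.  THEOREMS ONLY (no definition, no instance, no notation, no named
fact, no `sorry`); any field `K` (no valuation needed).  Cell `pub/hodgecm-mathlib` (D-0151), crux H413 = `stmt-HodgeConjecture-24833`, organ (D-RAM) `stub_DyRamCore`,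
«FOUR-FRAME» road.  Every row Prop of the road quantifies over the TYPE-(1) literal `γ` whose one-place matrix is `z · Γ_b`, `Γ_b = frameElt σ f b α β = 1 + (α−1)π₁ + (β−1)π₂`
(H8) in a four-frame family `f` (H7), `α, β, z ∈ E¹`, `α ≠ β`, `α, β ≠ 1`; the orbital-integral side needs `γ` REGULAR with COMPACT centraliser, both of which are read off an
EIGENFRAME (★ `isRegularElt_of_eigenframe`, ★ `compactSpace_centralizer_of_eigenframe_of_smul_eq`).  THIS FILE produces that eigenframe in the abstract currency:
the FRAME MATRIX `Q_b = (Matrix.of (f b))ᵀ` (columns `f_b,0, f_b,1, f_b,2`) is invertible (§2: a `Φ₃`-orthogonal family with non-zero norms is free — pair a relation with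
`f_b,j`), `Γ_b · f_b,i = (α, β, 1)_i · f_b,i` (§1: the projection calculus `π_j f_i = δ_ij f_i`, ★ `frameProj_mulVec`), hence `(z·Γ_b)·Q_b = Q_b·diag(zα, zβ, z)` (§3) and
`charpoly(z·Γ_b) = ∏ (X − (zα, zβ, z)_i)`, SEPARABLE iff the three eigenvalues are pairwise distinct, which holds for `α ≠ β`, `α ≠ 1`, `β ≠ 1`, `z ≠ 0` (§4).

* §1 `frameProj_mulVec_frame_self`, `frameProj_mulVec_frame_of_ne`, **`frameElt_mulVec_frame`** (`Γ_b f_i = λ_i f_i`).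
* §2 `frameMatrix_mulVec`, `frameMatrix_mulVec_injective`, **`isUnit_det_frameMatrix`**.
* §3 **`frameElt_mul_frameMatrix`**, **`smul_frameElt_mul_frameMatrix`**, `exists_eigenframe_smul_frameElt` (GL form).
* §4 `injective_eigenvalues`, **`charpoly_smul_frameElt`**, **`separable_charpoly_smul_frameElt`**.

NOT HERE: the CM-place transport to `LocalRing L v` and the two ★ consumers (regularity, compact centraliser) — the (D-G) engine file.  HONEST LABEL: HC_CM is proved only
modulo the 7 printed citations (2 remaining named inputs: hLiu418 = stmt-HodgeConjecture-24832, h413 = stmt-HodgeConjecture-24833) until rung 0 closes; linear algebra only.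
-/

noncomputable section

open scoped Matrix MatrixGroups
open Finset Polynomial

namespace Literature.NumberTheory.Automorphic.UnitaryThreeFourFrame

open Literature.NumberTheory.Automorphic Literature.NumberTheory.Automorphic.HermitianLattice
  Literature.NumberTheory.Automorphic.UnitaryLatticeTree

variable {K : Type} [Field K]

/-! ## §1  The projection calculus on the frame vectors and the eigenvector equations -/

/-- `π_f f = f` for `N(f) ≠ 0`. [cite: Jacobowitz1962, §4] -/
theorem frameProj_mulVec_frame_self (σ : K →+* K) {f : Fin 3 → K} (hf : pairing σ ((StdForm.antidiagonal 3).over K) f f ≠ 0) :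
    frameProj σ f *ᵥ f = f := by
  rw [frameProj_mulVec, inv_mul_cancel₀ hf, one_smul]

/-- `π_f g = 0` for `⟨f, g⟩ = 0`. [cite: Jacobowitz1962, §4] -/
theorem frameProj_mulVec_frame_of_pairing_eq_zero (σ : K →+* K) {f g : Fin 3 → K} (hfg : pairing σ ((StdForm.antidiagonal 3).over K) f g = 0) :
    frameProj σ f *ᵥ g = 0 := by
  rw [frameProj_mulVec, hfg, mul_zero, zero_smul]

/-- **THE FRAME VECTORS ARE EIGENVECTORS OF `Γ_b`: `Γ_b · f_b,i = (α, β, 1)_i · f_b,i`** (`Γ_b = 1 + (α−1)π₁ + (β−1)π₂`, `π_j f_i = δ_ij f_i`).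
[cite: Rogawski1990, §3.6 p. 31] [cite: Jacobowitz1962, §4] -/
theorem frameElt_mulVec_frame {σ : K →+* K} {f : Fin 4 → Fin 3 → (Fin 3 → K)} (hf : IsFourFrameFamily σ f) (b : Fin 4) (α β : K) (i : Fin 3) :
    frameElt σ f b α β *ᵥ f b i = (![α, β, 1] : Fin 3 → K) i • f b i := by
  obtain ⟨horth, hnz, -, -, -⟩ := hf b
  have key : ∀ j : Fin 3, frameElt σ f b α β *ᵥ f b j =
      f b j + (α - 1) • (frameProj σ (f b 0) *ᵥ f b j) + (β - 1) • (frameProj σ (f b 1) *ᵥ f b j) := fun j => by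
    rw [frameElt, Matrix.add_mulVec, Matrix.add_mulVec, Matrix.one_mulVec, Matrix.smul_mulVec, Matrix.smul_mulVec]
  rw [key]
  fin_cases i
  · show f b 0 + (α - 1) • (frameProj σ (f b 0) *ᵥ f b 0) + (β - 1) • (frameProj σ (f b 1) *ᵥ f b 0) = (![α, β, 1] : Fin 3 → K) 0 • f b 0
    have h0 : (![α, β, 1] : Fin 3 → K) 0 = α := rfl
    rw [frameProj_mulVec_frame_self σ (hnz 0), frameProj_mulVec_frame_of_pairing_eq_zero σ (horth 1 0 (by decide)), smul_zero, add_zero, h0]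
    module
  · show f b 1 + (α - 1) • (frameProj σ (f b 0) *ᵥ f b 1) + (β - 1) • (frameProj σ (f b 1) *ᵥ f b 1) = (![α, β, 1] : Fin 3 → K) 1 • f b 1
    have h1 : (![α, β, 1] : Fin 3 → K) 1 = β := rfl
    rw [frameProj_mulVec_frame_of_pairing_eq_zero σ (horth 0 1 (by decide)), frameProj_mulVec_frame_self σ (hnz 1), smul_zero, add_zero, h1]
    module
  · show f b 2 + (α - 1) • (frameProj σ (f b 0) *ᵥ f b 2) + (β - 1) • (frameProj σ (f b 1) *ᵥ f b 2) = (![α, β, 1] : Fin 3 → K) 2 • f b 2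
    rw [frameProj_mulVec_frame_of_pairing_eq_zero σ (horth 0 2 (by decide)), frameProj_mulVec_frame_of_pairing_eq_zero σ (horth 1 2 (by decide)),
      smul_zero, smul_zero, add_zero, add_zero]
    have h2 : (![α, β, 1] : Fin 3 → K) 2 = 1 := rfl
    rw [h2, one_smul]

/-! ## §2  The frame matrix `Q_b = (Matrix.of (f b))ᵀ` (columns `f_b,i`) is invertible -/

/-- `Q_b · c = Σ_i c_i · f_b,i`. [cite: Jacobowitz1962, §4] -/
theorem frameMatrix_mulVec (f : Fin 4 → Fin 3 → (Fin 3 → K)) (b : Fin 4) (c : Fin 3 → K) :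
    (Matrix.of (f b))ᵀ *ᵥ c = ∑ i, c i • f b i := by
  ext m
  simp only [Matrix.mulVec, dotProduct, Matrix.transpose_apply, Matrix.of_apply, Finset.sum_apply, Pi.smul_apply, smul_eq_mul, mul_comm (c _)]

/-- A `Φ₃`-orthogonal family with non-zero norms is free: `Q_b · c = 0 ⇒ c = 0` (pair with `f_b,j`: `⟨f_j, Σ c_i f_i⟩ = c_j N(f_j)`). [cite: Jacobowitz1962, §4] -/
theorem frameMatrix_mulVec_injective {σ : K →+* K} {f : Fin 4 → Fin 3 → (Fin 3 → K)} (hf : IsFourFrameFamily σ f) (b : Fin 4) :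
    Function.Injective fun c : Fin 3 → K => (Matrix.of (f b))ᵀ *ᵥ c := by
  obtain ⟨horth, hnz, -, -, -⟩ := hf b
  -- a linear map with trivial kernel
  have hker : ∀ c : Fin 3 → K, (Matrix.of (f b))ᵀ *ᵥ c = 0 → c = 0 := by
    intro c hc
    rw [frameMatrix_mulVec] at hc
    funext j
    have h := congrArg (pairing σ ((StdForm.antidiagonal 3).over K) (f b j)) hc
    rw [map_sum, map_zero, Finset.sum_eq_single j] at h
    · rw [map_smul, smul_eq_mul] at h
      exact (mul_eq_zero.1 h).resolve_right (hnz j)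
    · intro i _ hij
      rw [map_smul, horth j i (Ne.symm hij), smul_zero]
    · exact fun hj => (hj (Finset.mem_univ j)).elim
  intro c c' hcc'
  have h0 : (Matrix.of (f b))ᵀ *ᵥ (c - c') = 0 := by
    rw [Matrix.mulVec_sub]; exact sub_eq_zero.2 hcc'
  exact sub_eq_zero.1 (hker _ h0)

/-- **The frame matrix is invertible.** [cite: Jacobowitz1962, §4] -/
theorem isUnit_det_frameMatrix {σ : K →+* K} {f : Fin 4 → Fin 3 → (Fin 3 → K)} (hf : IsFourFrameFamily σ f) (b : Fin 4) :
    IsUnit ((Matrix.of (f b))ᵀ).det := by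
  rw [← Matrix.isUnit_iff_isUnit_det, ← Matrix.mulVec_injective_iff_isUnit]
  exact frameMatrix_mulVec_injective hf b

/-! ## §3  The eigenframe identities -/

/-- **`Γ_b · Q_b = Q_b · diag(α, β, 1)`.** [cite: Rogawski1990, §3.6 p. 31] -/
theorem frameElt_mul_frameMatrix {σ : K →+* K} {f : Fin 4 → Fin 3 → (Fin 3 → K)} (hf : IsFourFrameFamily σ f) (b : Fin 4) (α β : K) :
    frameElt σ f b α β * (Matrix.of (f b))ᵀ = (Matrix.of (f b))ᵀ * Matrix.diagonal ![α, β, 1] := by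
  ext m i
  have h := congrFun (frameElt_mulVec_frame hf b α β i) m
  rw [Matrix.mul_diagonal, Matrix.transpose_apply, Matrix.of_apply, mul_comm]
  rw [Pi.smul_apply, smul_eq_mul] at h
  rw [← h, Matrix.mulVec, dotProduct]
  simp only [Matrix.mul_apply, Matrix.transpose_apply, Matrix.of_apply]

/-- **`(z·Γ_b) · Q_b = Q_b · diag(zα, zβ, z)`** — the eigenframe of the organ's literal. [cite: Rogawski1990, §3.6 p. 31; §4.9 p. 54] -/
theorem smul_frameElt_mul_frameMatrix {σ : K →+* K} {f : Fin 4 → Fin 3 → (Fin 3 → K)} (hf : IsFourFrameFamily σ f) (b : Fin 4) (α β z : K) :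
    (z • frameElt σ f b α β) * (Matrix.of (f b))ᵀ = (Matrix.of (f b))ᵀ * Matrix.diagonal ![z * α, z * β, z] := by
  have hd : (Matrix.diagonal ![z * α, z * β, z] : Matrix (Fin 3) (Fin 3) K) = z • Matrix.diagonal ![α, β, 1] := by
    rw [← Matrix.diagonal_smul]
    congr 1
    funext i
    fin_cases i <;> simp
  rw [Matrix.smul_mul, frameElt_mul_frameMatrix hf b α β, hd, Matrix.mul_smul]

/-- **GL form of the eigenframe**: `∃ Q ∈ GL₃(K)`, `Q = Q_b`, with `(z·Γ_b)·Q = Q·diag(zα, zβ, z)`. [cite: Rogawski1990, §3.6 p. 31] -/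
theorem exists_eigenframe_smul_frameElt {σ : K →+* K} {f : Fin 4 → Fin 3 → (Fin 3 → K)} (hf : IsFourFrameFamily σ f) (b : Fin 4) (α β z : K) :
    ∃ Q : GL (Fin 3) K, (Q : Matrix (Fin 3) (Fin 3) K) = (Matrix.of (f b))ᵀ ∧
      (z • frameElt σ f b α β) * (Q : Matrix (Fin 3) (Fin 3) K) = (Q : Matrix (Fin 3) (Fin 3) K) * Matrix.diagonal ![z * α, z * β, z] :=
  ⟨(isUnit_det_frameMatrix hf b |> (Matrix.isUnit_iff_isUnit_det _).2).unit, rfl, smul_frameElt_mul_frameMatrix hf b α β z⟩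

/-! ## §4  The characteristic polynomial and its separability -/

/-- The three eigenvalues `(zα, zβ, z)` are pairwise distinct for a regular datum (`α ≠ β`, `α ≠ 1`, `β ≠ 1`) and `z ≠ 0`. [cite: Rogawski1990, §3.6 p. 31] -/
theorem injective_eigenvalues {α β z : K} (hαβ : α ≠ β) (hα1 : α ≠ 1) (hβ1 : β ≠ 1) (hz : z ≠ 0) :
    Function.Injective (![z * α, z * β, z] : Fin 3 → K) := by
  have h1 : z * α ≠ z * β := fun h => hαβ (mul_left_cancel₀ hz h)
  have h2 : z * α ≠ z := fun h => hα1 (mul_left_cancel₀ hz (by rw [mul_one]; exact h))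
  have h3 : z * β ≠ z := fun h => hβ1 (mul_left_cancel₀ hz (by rw [mul_one]; exact h))
  intro i j hij
  fin_cases i <;> fin_cases j
  all_goals first | rfl | (exfalso; revert hij; simp [h1, h2, h3, h1.symm, h2.symm, h3.symm])

/-- **`charpoly(z·Γ_b) = (X − zα)(X − zβ)(X − z)`** (conjugate to the diagonal by the frame matrix). [cite: Rogawski1990, §3.6 p. 31; §4.9 p. 54] -/
theorem charpoly_smul_frameElt {σ : K →+* K} {f : Fin 4 → Fin 3 → (Fin 3 → K)} (hf : IsFourFrameFamily σ f) (b : Fin 4) (α β z : K) :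
    (z • frameElt σ f b α β).charpoly = ∏ i : Fin 3, (X - C ((![z * α, z * β, z] : Fin 3 → K) i)) := by
  obtain ⟨Q, -, hQ⟩ := exists_eigenframe_smul_frameElt hf b α β z
  have hdQ : IsUnit (Q : Matrix (Fin 3) (Fin 3) K).det := Matrix.isUnits_det_units Q
  have ht : z • frameElt σ f b α β = (Q : Matrix (Fin 3) (Fin 3) K) * Matrix.diagonal ![z * α, z * β, z] * (Q : Matrix (Fin 3) (Fin 3) K)⁻¹ := by
    rw [← hQ, Matrix.mul_assoc, Matrix.mul_nonsing_inv _ hdQ, Matrix.mul_one]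
  rw [ht, Matrix.charpoly_units_conj, Matrix.charpoly_diagonal]

/-- **`charpoly(z·Γ_b)` IS SEPARABLE** for a regular datum (`α ≠ β`, `α ≠ 1`, `β ≠ 1`) and `z ≠ 0` — the regularity input of the organ's literal (via ★
`isRegularElt_iff_charpoly_localNonsplitEquiv` at a CM place). [cite: Rogawski1990, §3.1 p. 19; §3.6 p. 31] -/
theorem separable_charpoly_smul_frameElt {σ : K →+* K} {f : Fin 4 → Fin 3 → (Fin 3 → K)} (hf : IsFourFrameFamily σ f) (b : Fin 4) {α β z : K}
    (hαβ : α ≠ β) (hα1 : α ≠ 1) (hβ1 : β ≠ 1) (hz : z ≠ 0) :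
    ((z • frameElt σ f b α β).charpoly).Separable := by
  rw [charpoly_smul_frameElt hf b α β z]
  exact Polynomial.separable_prod_X_sub_C_iff.2 (injective_eigenvalues hαβ hα1 hβ1 hz)

end Literature.NumberTheory.Automorphic.UnitaryThreeFourFrame

end
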